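/- Copyright: the b2b-balaban cell (near-miss cell 7), T⁴-continuum CRUX team (coordinator ruling e34b3e0c item (2)), row NE7b,
lineage t4-ne7b-formalise-leaf-02 (gen 124; E-side ∕ key-readings lineage) — STATEMENT-FIRST STAGED BYTES for gaps-ne6 g7's LOCATED ASK
A-gapsne6-g7-1 (journal l.50893, cc leaf-02 by locus; numbering ∕ typist are the OWNER `t4-ne7b-p1`'s).  Released under the licence
of the surrounding project. -/
import Summits.QuantumFields.BalabanUV.T4Continuum.Spine.NE7b.PrefixExtractionLaws
import Summits.QuantumFields.BalabanUV.T4Continuum.Support.B16HistoryReprReadCausal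
import Summits.QuantumFields.BalabanUV.T4Continuum.Support.HistoryRealiseCellsRunAssemblyWTVSData
import Summits.QuantumFields.BalabanUV.T4Continuum.Support.HistoryRealiseCellsRunSupplyWTVSSanity

/-!
# THE KEY PATTERN OF A KEY FIBRE: the least prefix pattern whose class reads the fibre, and the fibre of every bad key of record
# lies in its pattern class (E-side bookkeeping for the re-cut road's `extractA` ∕ `fibM`)

Crux-route work under `Spine/NE7b/` of the T⁴-continuum cell (rung (B)+1 on a FINITE torus only; NOT infinite volume, NOT the mass
gap, NOT Clay; NOT a proof of NE7b — `T4WeightBudget.RelWeightBound`, the cell's OWN estimate, NOT PRINTED, NOT PROVED).  [folklore]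
finite combinatorics over the TREE's own objects: gaps-ne6's pattern classes (`PrefixExtraction.admS`, `PrefixExtractionLaws.histIdx ∕ badx`),
the (α)-instance's tower and skeleton (`B16HistoryReprChain.Tower`, `B16HistoryReprInstance.skelFam ∕ hsmall`), the key fibres
(`T4LiveClassFibration.fibre`) and, at the step reading, the record's key family of record (`HistoryRealiseCellsRunAssemblyWTVSData.kmemA ∕
memA`, `B16HistoryReprReadCausal.StepReading.reading`).  No `structure`, no `[cite:]` tag, no `def … : Prop`, nothing of Bałaban's, zero
`sorry`.

WHY.  The re-cut (α) road displays, per bad key `k`, `extractA` ∕ `fibM` («the partial sum over the key fibre is at most `qA K k` times the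
full sum»).  `PrefixExtractionLaws.extract_of_prefix_of_subset` supplies it from THREE inputs: (α) a READING `hread : fibre (kmemA …) (termSet
(skelFam T p₀)) K k ⊆ badx T p₀ S K k` of the fibre into the pattern class of some prefix pattern `S K k`, (β) the one-step displays `hrel` along
`S K k` (LCS-j per pinned event — NOT here), (γ) the telescoping displays (in the tree).  THIS FILE types (α) for THE CANONICAL PATTERN.

WHAT.  §1 tower combinatorics (`Tower.take_mem_adm`, `apply_mem_branch`; `PrefixExtraction.take_mem_admS`, `mem_admS_of_forall`,
`forall_of_mem_admS`; `badx_mono`).  §2 for ANY key map `kmem` on the skeleton's terms: **`keyPattern T p₀ kmem K k j g`** := the admissible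
next choices `p` after `g` THROUGH WHICH SOME HISTORY OF THE FIBRE PASSES (`histIdx T p₀ K h ∈ fibre kmem … K k` and `h|_{j+1} = snoc g p`) —
the projection of the fibre onto step `j`; `mem_termSet_skelFam` (a term of the skeleton is the large-summand term of an admissible history
`≠ hsmall` or the one all-small term); **`fibre_subset_badx_keyPattern`** — if the all-small term's key is not `k`, the fibre of `k` lies in the
key pattern's class; **`keyPattern_subset_of_fibre_subset`** — MINIMALITY: any prefix pattern `S` whose class reads the fibre contains the key
pattern pointwise (`keyPattern … j g ⊆ branch j g ∩ S K x j g`); so by `admS_mono` the per-step displays (β) along any such `S` imply those along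
`keyPattern`, i.e. (β) asked on `keyPattern` is the WEAKEST form, and the causal identification «`p ∈ keyPattern … j g` ⇒ `p` realises the
events `k` books at level `j` under the step reading» (J2a) is a lemma ABOUT `keyPattern`, to be proved where (β)'s analysis wants it.  §3 at
the step reading `𝒮.reading T p₀`: `liveCV_small_eq_empty` ∕ `kmemA_small_eq_empty` (under `hν0` — the small choice names no region — the
all-small term has no live name, hence the empty key family; `Nof_eq_empty` + `RunInputM.comp_histV_eq_empty_of_N`), `kmemA_ne_empty_of_mem_badGMems`
(a bad term has a member: `mem_badTerms` ∕ `mem_memOf`), and **`fibre_kmemA_subset_badx`** = the ask's (α) with `S := keyPattern`, its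
`hread` DISCHARGED for every bad key of record.

HONEST.  Bookkeeping on OUR carriers; nothing of Bałaban's read anew, asserted, valued or discharged; the display `extractA` ∕ `fibM` still
OWES (β) = LCS-j per pinned event along the key pattern (print's KIND, [Balaban1989LargeFieldII] (1.79) p. 383 as LOCATOR only) and
(A1c)'s identification; BY-NAME EFFECT ON THE WALL: NONE.  NE7b NOT PRINTED ∕ NOT PROVED; spine PROVED 0∕9.  HONEST DEPENDENCY (cell):
continuum YM on T⁴ ⇐ BetaPertH ∧ nine spine estimates (0/9 proved); BetaPertH ⇐ (D1) ∧ (D4) ∧ CAP+tail; G-an2-4 gates asym, D1 and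
NE2/3/4.  This file changes none of it.
-/

open Finset
open Literature.MathematicalPhysics.QuantumFieldTheory.Balaban1983to89
open Literature.MathematicalPhysics.QuantumFieldTheory.Balaban1983to89.T4LiveClassFibration
open Literature.MathematicalPhysics.QuantumFieldTheory.Balaban1983to89.T4PersistenceDictionary
open Literature.MathematicalPhysics.QuantumFieldTheory.Balaban1983to89.B13ScaleTransfer
open Summit.QuantumFields.BalabanUV.T4Continuum.B16HistoryReprChain
open Summit.QuantumFields.BalabanUV.T4Continuum.B16HistoryReprInstance
open Summit.QuantumFields.BalabanUV.T4Continuum.B16HistoryIndexedRepr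
open Summit.QuantumFields.BalabanUV.T4Continuum.B16HistoryReprReadCausal
open Summit.QuantumFields.BalabanUV.T4Continuum.HistoryGenealogyInstantiate
open Summit.QuantumFields.BalabanUV.T4Continuum.HistoryAssemblyTerms
open Summit.QuantumFields.BalabanUV.T4Continuum.HistoryAssemblyPedigree
open Summit.QuantumFields.BalabanUV.T4Continuum.HistoryAssemblyMult
open Summit.QuantumFields.BalabanUV.T4Continuum.HistoryAssemblyMultKey
open Summit.QuantumFields.BalabanUV.T4Continuum.HistoryRealiseCellsRunAssemblyWTVSData
open Summit.QuantumFields.BalabanUV.T4Continuum.NE7b.PrefixExtraction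
open Summit.QuantumFields.BalabanUV.T4Continuum.NE7b.PrefixExtractionLaws

/-! ## §1 Tower combinatorics: prefixes of admissible histories; the pattern class read pointwise; monotonicity of `badx` -/

namespace Summit.QuantumFields.BalabanUV.T4Continuum.B16HistoryReprChain.Tower

variable {P : Type} {C : ℕ → Type*} {𝒢 : (j : ℕ) → GoodClass (C j)} (T : Tower P C 𝒢)

/-- **PREFIXES OF AN ADMISSIBLE HISTORY ARE ADMISSIBLE.** [folklore] -/
theorem take_mem_adm : ∀ {K : ℕ} {h : Fin K → P}, h ∈ T.adm K → ∀ m (hm : m ≤ K), Fin.take m hm h ∈ T.adm m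
  | 0, h, _, m, hm => by
      obtain rfl : m = 0 := Nat.le_zero.1 hm
      show _ ∈ (Finset.univ : Finset (Fin 0 → P))
      exact Finset.mem_univ _
  | K + 1, h, hh, m, hm => by
      rcases Nat.lt_or_eq_of_le hm with hlt | rfl
      · have hg : Fin.init h ∈ T.adm K := ((T.mem_adm_succ h).1 hh).1
        exact take_mem_adm hg m (Nat.le_of_lt_succ hlt)
      · rw [Fin.take_eq_self]; exact hh

/-- **EACH CHOICE OF AN ADMISSIBLE HISTORY IS AN ADMISSIBLE NEXT CHOICE AFTER ITS PREFIX.** [folklore] -/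
theorem apply_mem_branch {K : ℕ} {h : Fin K → P} (hh : h ∈ T.adm K) (j : Fin K) :
    h j ∈ T.branch j (Fin.take j (Nat.le_of_lt j.2) h) := by
  have h1 := T.take_mem_adm hh (j + 1) j.2
  rw [Fin.take_succ_eq_snoc] at h1
  have h2 := ((T.mem_adm_succ _).1 h1).2
  simpa only [Fin.init_snoc, Fin.snoc_last] using h2

end Summit.QuantumFields.BalabanUV.T4Continuum.B16HistoryReprChain.Tower

namespace Summit.QuantumFields.BalabanUV.T4Continuum.NE7b.PrefixExtraction

variable {P : Type} [DecidableEq P] {C : ℕ → Type} {𝒢 : (j : ℕ) → GoodClass (C j)} (T : Tower P C 𝒢)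
  {S : (j : ℕ) → (Fin j → P) → Finset P}

/-- **AN ADMISSIBLE HISTORY WHOSE EVERY CHOICE LIES IN THE PATTERN HAS ALL ITS PREFIXES IN THE PATTERN CLASS.** [folklore] -/
theorem take_mem_admS {K : ℕ} {h : Fin K → P} (hh : h ∈ T.adm K)
    (hS : ∀ j : Fin K, h j ∈ S j (Fin.take j (Nat.le_of_lt j.2) h)) :
    ∀ m (hm : m ≤ K), Fin.take m hm h ∈ admS T S m
  | 0, _ => by
      show _ ∈ (Finset.univ : Finset (Fin 0 → P))
      exact Finset.mem_univ _
  | m + 1, hm => by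
      rw [Fin.take_succ_eq_snoc m hm h]
      refine (mem_admS_succ T S _).2 ⟨?_, ?_, ?_⟩
      · simpa only [Fin.init_snoc] using take_mem_admS hh hS m (Nat.le_of_succ_le hm)
      · simpa only [Fin.init_snoc, Fin.snoc_last] using T.apply_mem_branch hh ⟨m, hm⟩
      · simpa only [Fin.init_snoc, Fin.snoc_last] using hS ⟨m, hm⟩

/-- … in particular the history itself lies in the pattern class. [folklore] -/
theorem mem_admS_of_forall {K : ℕ} {h : Fin K → P} (hh : h ∈ T.adm K)
    (hS : ∀ j : Fin K, h j ∈ S j (Fin.take j (Nat.le_of_lt j.2) h)) : h ∈ admS T S K := by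
  simpa only [Fin.take_eq_self] using take_mem_admS T hh hS K le_rfl

/-- **CONVERSELY, EVERY CHOICE OF A PATTERN HISTORY LIES IN THE PATTERN AFTER ITS PREFIX.** [folklore] -/
theorem forall_of_mem_admS : ∀ {K : ℕ} {h : Fin K → P}, h ∈ admS T S K →
    ∀ j : Fin K, h j ∈ S j (Fin.take j (Nat.le_of_lt j.2) h)
  | 0, _, _, j => j.elim0
  | K + 1, h, hh, j => by
      obtain ⟨hg, -, hs⟩ := (mem_admS_succ T S h).1 hh
      rcases Fin.eq_castSucc_or_eq_last j with ⟨i, rfl⟩ | rfl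
      · exact forall_of_mem_admS hg i
      · exact hs

end Summit.QuantumFields.BalabanUV.T4Continuum.NE7b.PrefixExtraction

namespace Summit.QuantumFields.BalabanUV.T4Continuum.NE7b.PrefixExtractionLaws

variable {P : Type} [DecidableEq P] {C : ℕ → ℕ → Type} {𝒢 : (K j : ℕ) → GoodClass (C K j)}
  (T : (K : ℕ) → Tower P (C K) (𝒢 K)) (p₀ : ℕ → ℕ → P) {α : Type*}

/-- **THE PINNED CLASS AS TERMS IS MONOTONE IN THE PATTERN** (`admS_mono` under the term map). [folklore] -/
theorem badx_mono {S S' : (K : ℕ) → α → (j : ℕ) → (Fin j → P) → Finset P} {K : ℕ} {x : α}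
    (hS : ∀ j g, S K x j g ⊆ S' K x j g) : badx T p₀ S K x ⊆ badx T p₀ S' K x :=
  Finset.map_subset_map.2 (admS_mono (T := T K) hS K)

/-- **THE TERMS OF THE SKELETON AT CUTOFF `K`**: the large-summand term `histIdx T p₀ K h` of an admissible history `h ≠ hsmall`, or the one
all-small term. [folklore] -/
theorem mem_termSet_skelFam {K : ℕ} {τ : HIndex.Idx (skelFam T p₀)} (hτ : τ ∈ HIndex.termSet (skelFam T p₀) K) :
    (∃ h ∈ ((T K).adm K).erase (hsmall (p₀ K) K), τ = histIdx T p₀ K h) ∨ τ = ⟨K, false, (hsmall (p₀ K) K, (), ())⟩ := by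
  obtain ⟨⟨a, ι⟩, hι, rfl⟩ := Finset.mem_map.1 hτ
  have hz : ι.1 ∈ (skelFam T p₀ K).HZs a := (Finset.mem_product.1 (Finset.mem_sigma.1 hι).2).1
  cases a with
  | true =>
      refine Or.inl ⟨ι.1, ?_, rfl⟩
      simpa only [skelFam, skel, ↓reduceIte] using hz
  | false =>
      refine Or.inr ?_
      have h1 : ι.1 = hsmall (p₀ K) K := by
        simpa only [skelFam, skel, Bool.false_eq_true, ↓reduceIte, Finset.mem_singleton] using hz
      show (⟨K, false, (ι.1, (), ())⟩ : HIndex.Idx (skelFam T p₀)) = _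
      rw [h1]

end Summit.QuantumFields.BalabanUV.T4Continuum.NE7b.PrefixExtractionLaws

/-! ## §2 The key pattern of a key fibre, for any key map on the skeleton's terms -/

namespace Summit.QuantumFields.BalabanUV.T4Continuum.NE7b.KeyPatternReading

noncomputable section

section KeyPattern

variable {P : Type} [DecidableEq P] {C : ℕ → ℕ → Type} {𝒢 : (K j : ℕ) → GoodClass (C K j)}
  (T : (K : ℕ) → Tower P (C K) (𝒢 K)) (p₀ : ℕ → ℕ → P) {ω : Type*} [DecidableEq ω]
  (kmem : ℕ → HIndex.Idx (skelFam T p₀) → ω)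

open scoped Classical in
/-- **THE KEY PATTERN OF THE KEY `k` AT CUTOFF `K`** (for the key map `kmem` on the skeleton's terms): after the prefix `g` of `j` steps, the
admissible next choices `p` THROUGH WHICH SOME HISTORY OF THE FIBRE OF `k` PASSES — some `h` with `histIdx T p₀ K h ∈ fibre kmem (termSet …) K k`
and `h|_{j+1} = snoc g p`.  The projection of the key fibre onto step `j`; data, nothing asserted. [folklore] -/
def keyPattern (K : ℕ) (k : ω) (j : ℕ) (g : Fin j → P) : Finset P :=
  ((T K).branch j g).filter fun p => ∃ (h : Fin K → P) (hj : j < K),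
    histIdx T p₀ K h ∈ fibre kmem (HIndex.termSet (skelFam T p₀)) K k ∧ Fin.take (j + 1) hj h = Fin.snoc g p

/-- membership in the key pattern. [folklore] -/
theorem mem_keyPattern {K : ℕ} {k : ω} {j : ℕ} {g : Fin j → P} {p : P} :
    p ∈ keyPattern T p₀ kmem K k j g ↔ p ∈ (T K).branch j g ∧ ∃ (h : Fin K → P) (hj : j < K),
      histIdx T p₀ K h ∈ fibre kmem (HIndex.termSet (skelFam T p₀)) K k ∧ Fin.take (j + 1) hj h = Fin.snoc g p := by
  classical
  exact Finset.mem_filter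

/-- the key pattern consists of admissible next choices. [folklore] -/
theorem keyPattern_subset_branch (K : ℕ) (k : ω) (j : ℕ) (g : Fin j → P) : keyPattern T p₀ kmem K k j g ⊆ (T K).branch j g :=
  fun _ hp => ((mem_keyPattern T p₀ kmem).1 hp).1

/-- **A HISTORY OF THE FIBRE LIES IN THE KEY PATTERN's CLASS** (each of its choices is witnessed by the history itself). [folklore] -/
theorem mem_admS_keyPattern {K : ℕ} {k : ω} {h : Fin K → P} (hh : h ∈ (T K).adm K)
    (hk : histIdx T p₀ K h ∈ fibre kmem (HIndex.termSet (skelFam T p₀)) K k) :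
    h ∈ admS (T K) (keyPattern T p₀ kmem K k) K :=
  mem_admS_of_forall (T K) hh fun j => (mem_keyPattern T p₀ kmem).2
    ⟨(T K).apply_mem_branch hh j, h, j.2, hk, Fin.take_succ_eq_snoc j j.2 h⟩

/-- **THE FIBRE OF `k` LIES IN THE KEY PATTERN's PINNED CLASS** whenever the all-small term's key is not `k` (every other term of the skeleton
is the large-summand term of an admissible history, which lies in the class by `mem_admS_keyPattern`). [folklore] -/
theorem fibre_subset_badx_keyPattern (K : ℕ) (k : ω) (hsk : kmem K ⟨K, false, (hsmall (p₀ K) K, (), ())⟩ ≠ k) :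
    fibre kmem (HIndex.termSet (skelFam T p₀)) K k ⊆ badx T p₀ (keyPattern T p₀ kmem) K k := by
  intro τ hτ
  obtain ⟨hT, hkτ⟩ := mem_fibre.1 hτ
  rcases mem_termSet_skelFam T p₀ hT with ⟨h, hh, rfl⟩ | rfl
  · exact Finset.mem_map.2 ⟨h, mem_admS_keyPattern T p₀ kmem (Finset.mem_of_mem_erase hh) hτ, rfl⟩
  · exact absurd hkτ hsk

/-- **MINIMALITY: THE KEY PATTERN IS THE LEAST PREFIX PATTERN WHOSE CLASS READS THE FIBRE** — if `fibre kmem … K k ⊆ badx T p₀ S K x` then,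
after every prefix, the key pattern's choices are pattern choices of `S K x`.  (So the per-step displays along any such `S` imply those along
the key pattern, `admS_mono` ∕ `badx_mono`.) [folklore] -/
theorem keyPattern_subset_of_fibre_subset {α : Type*} (S : (K : ℕ) → α → (j : ℕ) → (Fin j → P) → Finset P) {K : ℕ} {k : ω}
    {x : α} (hread : fibre kmem (HIndex.termSet (skelFam T p₀)) K k ⊆ badx T p₀ S K x) (j : ℕ) (g : Fin j → P) :
    keyPattern T p₀ kmem K k j g ⊆ (T K).branch j g ∩ S K x j g := by
  intro p hp
  obtain ⟨hb, h, hj, hfib, htake⟩ := (mem_keyPattern T p₀ kmem).1 hp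
  refine Finset.mem_inter.2 ⟨hb, ?_⟩
  obtain ⟨h', hh', he⟩ := Finset.mem_map.1 (hread hfib)
  obtain rfl : h' = h := histIdx_injective T p₀ K he
  have hs := forall_of_mem_admS (T K) hh' ⟨j, hj⟩
  rw [Fin.take_succ_eq_snoc] at htake
  have hg : Fin.take j (Nat.le_of_lt hj) h' = g := by
    simpa only [Fin.init_snoc] using congrArg Fin.init htake
  have hpj : h' ⟨j, hj⟩ = p := by
    simpa only [Fin.snoc_last] using congrFun htake (Fin.last j)
  rw [← hg, ← hpj]
  exact hs

end KeyPattern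

/-! ## §3 At the step reading: the all-small term has the empty key family, a bad key is non-empty, and the ask's (α) -/

section Reading

variable {P : Type} [DecidableEq P] {d : ℕ} (𝒮 : StepReading P d) {C : ℕ → ℕ → Type} {𝒢 : (K j : ℕ) → GoodClass (C K j)}
  (T : (K : ℕ) → Tower P (C K) (𝒢 K)) (p₀ : ℕ → ℕ → P) (n L : ℕ) (hn : 0 < n) (hL : 0 < L)

/-- **THE ALL-SMALL TERM HAS NO LIVE NAME** when the small-field choice names no region (`hν0`): its run books no region (`Nof_eq_empty`), so
the pass-V bookkeeping has no component (`RunInputM.comp_histV_eq_empty_of_N`). [folklore] -/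
theorem liveCV_small_eq_empty (hν0 : ∀ K j g, 𝒮.ν K j g (p₀ K j) = ∅) (K : ℕ) :
    (𝒮.reading T p₀).inputOf.liveCV K ⟨K, false, (hsmall (p₀ K) K, (), ())⟩ = ∅ := by
  show (((𝒮.reading T p₀).runOf K false (hsmall (p₀ K) K, (), ())).histV.comp K).image (Prod.mk K) = ∅
  rw [RunInputM.comp_histV_eq_empty_of_N _ (𝒮.Nof_eq_empty fun j => hν0 K j _), Finset.image_empty]

/-- … hence THE EMPTY KEY FAMILY OF RECORD. [folklore] -/
theorem kmemA_small_eq_empty (hν0 : ∀ K j g, 𝒮.ν K j g (p₀ K j) = ∅) (K : ℕ) :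
    kmemA n L hn hL (𝒮.reading T p₀) K ⟨K, false, (hsmall (p₀ K) K, (), ())⟩ = ∅ := by
  show ((𝒮.reading T p₀).inputOf.liveCV K _).image _ = ∅
  rw [liveCV_small_eq_empty 𝒮 T p₀ hν0 K, Finset.image_empty]

omit [DecidableEq P] in
/-- **A BAD KEY OF RECORD IS NON-EMPTY** (for any reading: a bad term has a named member, `mem_badTerms`, i.e. a live name, whose key is in
the family). [folklore] -/
theorem kmemA_ne_empty_of_mem_badGMems {DomK : ℕ → Type} {I : (K : ℕ) → HIndex (DomK K)} (ℛ : HistReading I d)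
    {jstar : ℕ → ℕ} {K : ℕ} {k : Finset ((Fin d → ℕ) × Gen PEv × Multiset (PEv × ((Fin d → ℕ) × Finset (Pt d))))}
    (hk : k ∈ badGMems (memA n L ℛ) jstar (HIndex.termSet I) (kmemA n L hn hL ℛ) K) : k ≠ ∅ := by
  obtain ⟨τ, hτ, rfl⟩ := mem_badGMems.1 hk
  obtain ⟨-, q, hq, -⟩ := mem_badTerms.1 hτ
  obtain ⟨c, hc, -⟩ := mem_memOf.1 hq
  exact Finset.ne_empty_of_mem (Finset.mem_image_of_mem _ hc)

/-- **THE ASK's (α): THE FIBRE OF EVERY BAD KEY OF RECORD LIES IN ITS KEY PATTERN's PINNED CLASS** — `hread` of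
`PrefixExtractionLaws.extract_of_prefix_of_subset` ∕ `extractionLaws_of_prefix_of_subset` at `S := keyPattern T p₀ (kmemA …)`, DISCHARGED
(the small term's key is `∅` by `hν0`, a bad key is not). What the display `extractA` then owes is (β) along the key pattern only. [folklore] -/
theorem fibre_kmemA_subset_badx (hν0 : ∀ K j g, 𝒮.ν K j g (p₀ K j) = ∅) {jstar : ℕ → ℕ} {K : ℕ}
    {k : Finset ((Fin d → ℕ) × Gen PEv × Multiset (PEv × ((Fin d → ℕ) × Finset (Pt d))))}
    (hk : k ∈ badGMems (memA n L (𝒮.reading T p₀)) jstar (HIndex.termSet (skelFam T p₀)) (kmemA n L hn hL (𝒮.reading T p₀)) K) :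
    fibre (kmemA n L hn hL (𝒮.reading T p₀)) (HIndex.termSet (skelFam T p₀)) K k ⊆
      badx T p₀ (keyPattern T p₀ (kmemA n L hn hL (𝒮.reading T p₀))) K k :=
  fibre_subset_badx_keyPattern T p₀ _ K k (by
    rw [kmemA_small_eq_empty 𝒮 T p₀ n L hn hL hν0 K]
    exact (kmemA_ne_empty_of_mem_badGMems n L hn hL (𝒮.reading T p₀) hk).symm)

/-- **… ALONG ANY PATTERN CONTAINING THE KEY PATTERN** (the form a causal pattern `S ⊇ keyPattern` — «`p` realises the events `k` books at
level `j` under `𝒮`» — is consumed in: `badx_mono`). [folklore] -/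
theorem fibre_kmemA_subset_badx_of_subset (hν0 : ∀ K j g, 𝒮.ν K j g (p₀ K j) = ∅)
    {S : (K : ℕ) → Finset ((Fin d → ℕ) × Gen PEv × Multiset (PEv × ((Fin d → ℕ) × Finset (Pt d)))) → (j : ℕ) → (Fin j → P) →
      Finset P}
    (hS : ∀ K k j g, keyPattern T p₀ (kmemA n L hn hL (𝒮.reading T p₀)) K k j g ⊆ S K k j g) {jstar : ℕ → ℕ} {K : ℕ}
    {k : Finset ((Fin d → ℕ) × Gen PEv × Multiset (PEv × ((Fin d → ℕ) × Finset (Pt d))))}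
    (hk : k ∈ badGMems (memA n L (𝒮.reading T p₀)) jstar (HIndex.termSet (skelFam T p₀)) (kmemA n L hn hL (𝒮.reading T p₀)) K) :
    fibre (kmemA n L hn hL (𝒮.reading T p₀)) (HIndex.termSet (skelFam T p₀)) K k ⊆ badx T p₀ S K k :=
  (fibre_kmemA_subset_badx 𝒮 T p₀ n L hn hL hν0 hk).trans (badx_mono T p₀ (hS K k))

/-- **THE `hread` BINDER OF `PrefixExtractionLaws.extractionLaws_of_prefix_of_subset`, DISCHARGED** for the road's carriers: pinned classes
any `X K` inside the bad keys of record (e.g. the END's `if K₀ ≤ K then badGMems … K else ∅`), sub-classes the key fibres, patterns the key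
patterns. [folklore] -/
theorem hread_keyPattern (hν0 : ∀ K j g, 𝒮.ν K j g (p₀ K j) = ∅) {jstar : ℕ → ℕ}
    {X : ℕ → Finset (Finset ((Fin d → ℕ) × Gen PEv × Multiset (PEv × ((Fin d → ℕ) × Finset (Pt d)))))}
    (hX : ∀ K, X K ⊆ badGMems (memA n L (𝒮.reading T p₀)) jstar (HIndex.termSet (skelFam T p₀)) (kmemA n L hn hL (𝒮.reading T p₀)) K) :
    ∀ K, ∀ k ∈ X K, fibre (kmemA n L hn hL (𝒮.reading T p₀)) (HIndex.termSet (skelFam T p₀)) K k ⊆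
      badx T p₀ (keyPattern T p₀ (kmemA n L hn hL (𝒮.reading T p₀))) K k :=
  fun K _ hk => fibre_kmemA_subset_badx 𝒮 T p₀ n L hn hL hν0 (hX K hk)

end Reading

end

end Summit.QuantumFields.BalabanUV.T4Continuum.NE7b.KeyPatternReading
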